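import Literature.AlgebraicGeometry.AbelianSchemes.RoofBaseChangeAlongBaseIso        -- ★ p849519 (LA4-p01 (g2)) §1 TRANSFERS OF POINTS `pointsTransfer_*` along `e : Spec Ω′ → Spec Ω`
import Literature.AlgebraicGeometry.AbelianSchemes.SerreCoverTransportAlongIso        -- ★ p847952∕p848359 the COVER-WITH-KERNEL-CLAUSE SHAPE (`coverKer_transport_along_iso`)
import HarnessLib

/-!
# A SERRE COVER WITH ITS KERNEL CLAUSE over `Spec Ω` BASE-CHANGES along a morphism of point bases `e : Spec Ω′ → Spec Ω` (the `Ω`-points move by the TRANSFER of points)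

Topic `AlgebraicGeometry/AbelianSchemes`; namespace `Literature.AlgebraicGeometry.AbelianSchemes.AbelianSchemeOver`.  THEOREMS ONLY (no definition,
no named fact, no instance, no notation, no `sorry`).  Cell `hodgecm-mathlib` (D-0151), P6 «MOD programme» (crux hLiu418 = stmt-HodgeConjecture-24832,
`--supports`, count-neutral), line «L4», X-LEAF `Lines/F0_P6a_EExports.lean` (A-p01 (g28)) socket `stub_ECtoΩ` «transport of the E-readings from
`ℂ`-points to `F̄_w`-points along a ring isomorphism `σ : F̄_w ≃ ℂ` over `ι₁`» — the COVER half (LA4-plan (g0) DEAL #20′ (ii); LA4-p01 (g2) split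
05:17:48Z: (ii-R) roofs = ★ `RoofBaseChangeAlongBaseIso`, (ii-T) covers = THIS FILE; assembly pen LA4-p03 (g2)).  This file is the generic core of the
cover transport: the COVER-WITH-KERNEL-CLAUSE SHAPE of ★ `SerreCoverTransportAlongIso` §CoverKer (clauses (t1)(t1′)(t2)(t3)(t4)(t5) of the spine reader
`CoverKerΩ` ∕ the E-reading `CoverKerE`, readers abstracted: `act₁ act₁′ lam₁ lam₁′ pt₁ pt₁′ 𝔞 𝔟 ν n`) moves along the base change `e` of the point base, the
`Ω′`-side level points being the TRANSFERS (★ `pointsTransfer_map`) of the `Ω`-side ones; the X-leaf composes it with ★ `coverKer_transport_along_iso` to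
re-read `(𝒜 ×_X Spec Ω) ×_Ω Spec Ω′` as `𝒜 ×_X Spec Ω′`.  UNLIKE the roof, NO clause of the cover needs `e` to be an isomorphism (no kernel-on-points or
surjectivity clause; (t1′) is on ALL `T`-points and base-changes by transposition).
HC_CM is proved only modulo the 2 remaining named inputs (hLiu418 24832, h413 24833) until rung 0 closes; nothing here is about HC.

THE MATHEMATICS ([GortzWedhorn2020] (4.7), (4.15), Def. 4.45: base change is a functor, `T′`-points of `A ×_S S′` transpose to `T′`-points of `A`;
[MumfordFogartyKirwan1994] Ch. 6 §1 Cor. 6.4, 6.8 and Ch. 7 §2 Def. 7.2: homomorphisms, dual homomorphisms, polarisations and level sections base-change «in the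
obvious way»; [Shimura1998] §13.1 Thm. 1 ∕ §18.6 and [Conrad2004GrossZagier] §7 Thm. 7.5: the Serre `𝔞`-transform and its structure maps commute with base
change).  Let `c : A₁ → A₁′` be a homomorphism of abelian schemes over `Spec Ω` with (t1) a Serre presentation of `𝔞` («`∀ a ∈ 𝔞, ∃ d, c ≫ d = ι₁(a) ∧ d ≫ c = ι₁′(a)`»),
(t1′) the KERNEL CLAUSE on all `T`-points («`t ≫ c = 1 ↔ ∀ a ∈ 𝔞, t ≫ ι₁(a) = 1`»), (t2) the upper bound («`∀ b ∈ 𝔟, ∃ f, c ≫ ι₁′(b) = f ≫ ι₁′(ν)`»), (t3)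
`c ≫ λ₁′ ≫ c^∨ = λ₁ ≫ [n]`, (t4) `ι₁(a) ≫ c = c ≫ ι₁′(a)`, (t5) `c(pt₁ i) = pt₁′ i`.  Then `c ×_Ω Ω′ : A₁ ×_Ω Ω′ → A₁′ ×_Ω Ω′` has (t1)(t2)(t4) by functoriality of
`(–) ×_Ω Ω′`, (t1′) by ★ `comp_baseChangeHom_eq_one_iff_homEquiv_symm` (transposition along `Over.map e ⊣ Over.pullback e`), (t3) by ★
`DualPair.baseChangeHom_similitude_base`, and (t5) for the transferred points by ★ `pointsTransfer_map`.

* §1 `kernelClause_baseChangeHom` — (t1′) alone, for an abstract endomorphism family (the ★ `idealKernelLaw_baseChangeHom` of a `RingAction`, reader-free);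
* §2 **`coverKer_baseChange_of_transfer`** — THE HEAD (cover-with-kernel-clause shape over `Ω` ⟹ the same shape over `Ω′` for the base-changed sides);
  `cover_baseChange_of_transfer` — the same without the kernel clause (the shape of ★ `cover_transport_along_iso` ∕ the readers `CoverΩ`∕`CoverE`).

## References
* [GortzWedhorn2020] U. Görtz, T. Wedhorn, *Algebraic Geometry I*, 2nd ed. (2020), Section (4.7) (pp. 107–108), (4.15) (p. 116), Definition 4.45 (2) (p. 117), Prop. 4.16 (p. 101).
* [MumfordFogartyKirwan1994] D. Mumford, J. Fogarty, F. Kirwan, *Geometric Invariant Theory*, 3rd ed. (1994), Ch. 6 §1 Cor. 6.4 (p. 117), Cor. 6.8 (p. 118); Ch. 7 §2 Def. 7.2 (p. 129).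
* [Shimura1998] G. Shimura, *Abelian Varieties with Complex Multiplication and Modular Functions* (1998), §13.1 Theorem 1 (pp. 97–99), §18.6 (pp. 124–127).
* [Conrad2004GrossZagier] B. Conrad, *Gross–Zagier revisited* (2004), §7 Thm. 7.5.
* [MumfordAV1970] D. Mumford, *Abelian Varieties* (1970), §7 Thm. 4 (p. 72); §15 Thm. 1 (p. 143).
-/

set_option autoImplicit false

noncomputable section

-- Mathlib's `Over`/pull-back API is stated across semireducible wrappers (as in the ★ `AbelianSchemes/*` files).
set_option backward.isDefEq.respectTransparency false

universe u

open CategoryTheory CategoryTheory.Limits AlgebraicGeometry MonoidalCategory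
open scoped MonObj Obj

namespace Literature.AlgebraicGeometry.AbelianSchemes

namespace AbelianSchemeOver

open Literature.AlgebraicGeometry.Motives (AlgPoints specOver)

/-! ### §1 The kernel clause (t1′) base-changes, for an abstract endomorphism family -/

section KernelClause

variable {S S' : Scheme.{u}} (g : S' ⟶ S) {A B : AbelianSchemeOver S} {O : Type*}

/-- **THE KERNEL CLAUSE BASE-CHANGES** (reader-free form of ★ `idealKernelLaw_baseChangeHom`): if `Ker φ` is cut out on ALL `T`-points over `S` by an endomorphism
family `ι` and a predicate `𝔞` (`t ≫ φ = 1 ↔ ∀ a, 𝔞 a → t ≫ ι(a) = 1`), then `Ker (φ ×_S S′)` is cut out on all `T′`-points over `S′` by `ι ×_S S′` and `𝔞` — a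
`T′`-point of `A ×_S S′` is a `T′`-point of `A` by transposition along `Over.map g ⊣ Over.pullback g` (★ `comp_baseChangeHom_eq_one_iff_homEquiv_symm`).
[cite: GortzWedhorn2020, (4.15) (p. 116) and Definition 4.45 (2) (p. 117)] [cite: Conrad2004GrossZagier, §7 (Thm. 7.5)] -/
theorem kernelClause_baseChangeHom (act : O → (A.X ⟶ A.X)) (φ : A.X ⟶ B.X) (𝔞 : O → Prop)
    (hφ : ∀ ⦃T : Over S⦄ (t : T ⟶ A.X), t ≫ φ = 1 ↔ ∀ a, 𝔞 a → t ≫ act a = 1)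
    ⦃T : Over S'⦄ (t : T ⟶ (A.baseChange g).X) :
    t ≫ baseChangeHom φ g = 1 ↔ ∀ a, 𝔞 a → t ≫ baseChangeHom (act a) g = 1 := by
  rw [comp_baseChangeHom_eq_one_iff_homEquiv_symm g φ t, hφ]
  refine forall₂_congr fun a _ => ?_
  exact (comp_baseChangeHom_eq_one_iff_homEquiv_symm g (act a) t).symm

end KernelClause

/-! ### §2 The cover shape (with and without the kernel clause) base-changes along `e : Spec Ω′ → Spec Ω` -/

section Cover

variable {Ω Ω' : Type u} [Field Ω] [Field Ω'] (e : Spec (.of Ω') ⟶ Spec (.of Ω))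
  {A₁ A₁' : AbelianSchemeOver (Spec (.of Ω))} (D₁ : A₁.DualPair) (D₁' : A₁'.DualPair)
  (lam₁ : A₁.X ⟶ D₁.hat.X) (lam₁' : A₁'.X ⟶ D₁'.hat.X)
  {O : Type*} (act₁ : O → (A₁.X ⟶ A₁.X)) (act₁' : O → (A₁'.X ⟶ A₁'.X))
  {J : Type*} (pt₁ : J → A₁.toAffine.toAbelianVariety.Points Ω) (pt₁' : J → A₁'.toAffine.toAbelianVariety.Points Ω)
  (𝔞 𝔟 : O → Prop) (ν : O) (n : ℕ)
  {ε₁ : A₁.toAffine.toAbelianVariety.Points Ω → (A₁.baseChange e).toAffine.toAbelianVariety.Points Ω'}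
  (hε₁ : ∀ P, (ε₁ P).left ≫ pullback.fst A₁.X.hom e = e ≫ P.left)
  {ε₁' : A₁'.toAffine.toAbelianVariety.Points Ω → (A₁'.baseChange e).toAffine.toAbelianVariety.Points Ω'}
  (hε₁' : ∀ P, (ε₁' P).left ≫ pullback.fst A₁'.X.hom e = e ≫ P.left)
  (pt₂ : J → (A₁.baseChange e).toAffine.toAbelianVariety.Points Ω') (pt₂' : J → (A₁'.baseChange e).toAffine.toAbelianVariety.Points Ω')

include hε₁ hε₁' in
/-- **THE HEAD — A SERRE COVER WITH ITS KERNEL CLAUSE BASE-CHANGES ALONG A MORPHISM OF POINT BASES.**  Let `e : Spec Ω′ ⟶ Spec Ω`, `ε₁`, `ε₁′` transfers of points for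
the two sides, and let the `Ω′`-side level points be the transferred ones (`pt₂ = ε₁ ∘ pt₁`, `pt₂′ = ε₁′ ∘ pt₁′`).  Then a cover `c : A₁ → A₁′` over `Spec Ω` with the
clauses (t1) Serre presentation of `𝔞`, (t1′) kernel clause on all `T`-points, (t2) upper bound through `𝔟` and `ν`, (t3) `c ≫ λ₁′ ≫ c^∨ = λ₁ ≫ [n]`, (t4)
`ι`-equivariance, (t5) `c(pt₁ i) = pt₁′ i` — the clause texts of ★ `coverKer_transport_along_iso` (= the readers `CoverKerΩ`∕`CoverKerE` with the readers
abstracted), so the X-leaf instantiates by unification — base-changes to the cover `c ×_Ω Ω′ : A₁ ×_Ω Ω′ → A₁′ ×_Ω Ω′` over `Spec Ω′` with the same clauses for the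
base-changed readers (`ι ↦ ι ×_Ω Ω′`, `λ ↦ λ ×_Ω Ω′`, dual pairs `D.baseChange e`, the same `𝔞 𝔟 ν n`) and the transferred points: (t1)(t2)(t4) functoriality of
`Over.pullback e`, (t1′) §1, (t3) ★ `DualPair.baseChangeHom_similitude_base`, (t5) ★ `pointsTransfer_map`.  No hypothesis on `e`.
[cite: MumfordFogartyKirwan1994, Ch. 6 §1 Corollary 6.8 (p. 118) and Ch. 7 §2 Definition 7.2 (p. 129)] [cite: GortzWedhorn2020, Section (4.7) (pp. 107–108) and (4.15) (p. 116)]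
[cite: Shimura1998, §13.1 Theorem 1 (pp. 97–99); §18.6 (pp. 124–127)] [cite: MumfordAV1970, §15 Thm. 1 (p. 143)] -/
theorem coverKer_baseChange_of_transfer
    (hpt : ∀ i, pt₂ i = ε₁ (pt₁ i)) (hpt' : ∀ i, pt₂' i = ε₁' (pt₁' i))
    (hcover : ∃ (c : A₁.X ⟶ A₁'.X) (_ : IsMonHom c),
        (∀ a, 𝔞 a → ∃ d : A₁'.X ⟶ A₁.X, c ≫ d = act₁ a ∧ d ≫ c = act₁' a) ∧
        (∀ ⦃T : Literature.AlgebraicGeometry.Motives.SchemeOver Ω⦄ (t : T ⟶ A₁.X), t ≫ c = 1 ↔ ∀ a, 𝔞 a → t ≫ act₁ a = 1) ∧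
        (∀ b, 𝔟 b → ∃ f : A₁.X ⟶ A₁'.X, c ≫ act₁' b = f ≫ act₁' ν) ∧
        c ≫ lam₁' ≫ DualPair.dualIsogenyOver c D₁ D₁' = lam₁ ≫ D₁.hat.mulN n ∧
        (∀ a, act₁ a ≫ c = c ≫ act₁' a) ∧
        (∀ i : J, (AlgPoints.map c (pt₁ i) : A₁'.toAffine.toAbelianVariety.Points Ω) = pt₁' i)) :
    ∃ (c : (A₁.baseChange e).X ⟶ (A₁'.baseChange e).X) (_ : IsMonHom c),
        (∀ a, 𝔞 a → ∃ d : (A₁'.baseChange e).X ⟶ (A₁.baseChange e).X,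
          c ≫ d = baseChangeHom (act₁ a) e ∧ d ≫ c = baseChangeHom (act₁' a) e) ∧
        (∀ ⦃T : Literature.AlgebraicGeometry.Motives.SchemeOver Ω'⦄ (t : T ⟶ (A₁.baseChange e).X),
          t ≫ c = 1 ↔ ∀ a, 𝔞 a → t ≫ baseChangeHom (act₁ a) e = 1) ∧
        (∀ b, 𝔟 b → ∃ f : (A₁.baseChange e).X ⟶ (A₁'.baseChange e).X,
          c ≫ baseChangeHom (act₁' b) e = f ≫ baseChangeHom (act₁' ν) e) ∧
        c ≫ baseChangeHom lam₁' e ≫ DualPair.dualIsogenyOver c (D₁.baseChange e) (D₁'.baseChange e) =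
          baseChangeHom lam₁ e ≫ (D₁.baseChange e).hat.mulN n ∧
        (∀ a, baseChangeHom (act₁ a) e ≫ c = c ≫ baseChangeHom (act₁' a) e) ∧
        (∀ i : J, (AlgPoints.map c (pt₂ i) : (A₁'.baseChange e).toAffine.toAbelianVariety.Points Ω') = pt₂' i) := by
  obtain ⟨c, hc, t1, t1', t2, t3, t4, t5⟩ := hcover
  haveI := hc
  refine ⟨baseChangeHom c e, isMonHom_baseChangeHom c e, fun a ha => ?_, kernelClause_baseChangeHom e act₁ c 𝔞 t1', fun b hb => ?_,
    DualPair.baseChangeHom_similitude_base e c D₁ D₁' lam₁ lam₁' n t3, fun a => ?_, fun i => ?_⟩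
  · -- (t1): the Serre presentation base-changes by functoriality
    obtain ⟨d, hcd, hdc⟩ := t1 a ha
    refine ⟨baseChangeHom d e, ?_, ?_⟩
    · change (Over.pullback e).map c ≫ (Over.pullback e).map d = (Over.pullback e).map (act₁ a)
      rw [← Functor.map_comp, hcd]
    · change (Over.pullback e).map d ≫ (Over.pullback e).map c = (Over.pullback e).map (act₁' a)
      rw [← Functor.map_comp, hdc]
  · -- (t2): the upper bound base-changes by functoriality
    obtain ⟨f, hf⟩ := t2 b hb
    refine ⟨baseChangeHom f e, ?_⟩
    change (Over.pullback e).map c ≫ (Over.pullback e).map (act₁' b) = (Over.pullback e).map f ≫ (Over.pullback e).map (act₁' ν)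
    rw [← Functor.map_comp, ← Functor.map_comp, hf]
  · -- (t4): equivariance base-changes by functoriality
    change (Over.pullback e).map (act₁ a) ≫ (Over.pullback e).map c = (Over.pullback e).map c ≫ (Over.pullback e).map (act₁' a)
    rw [← Functor.map_comp, ← Functor.map_comp, t4 a]
  · -- (t5): the transferred level points correspond (naturality of the transfer)
    rw [hpt, hpt', ← pointsTransfer_map hε₁ hε₁' c, t5 i]

include hε₁ hε₁' in
/-- **The same WITHOUT the kernel clause** — the cover shape of ★ `cover_transport_along_iso` ((t1)–(t5), = the readers `CoverΩ`∕`CoverE`) base-changes along `e`, the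
level points moved by the transfers. [cite: MumfordFogartyKirwan1994, Ch. 6 §1 Corollary 6.8 (p. 118) and Ch. 7 §2 Definition 7.2 (p. 129)]
[cite: GortzWedhorn2020, Section (4.7) (pp. 107–108)] [cite: Shimura1998, §13.1 Theorem 1 (pp. 97–99); §18.6 (pp. 124–127)] -/
theorem cover_baseChange_of_transfer
    (hpt : ∀ i, pt₂ i = ε₁ (pt₁ i)) (hpt' : ∀ i, pt₂' i = ε₁' (pt₁' i))
    (hcover : ∃ (c : A₁.X ⟶ A₁'.X) (_ : IsMonHom c),
        (∀ a, 𝔞 a → ∃ d : A₁'.X ⟶ A₁.X, c ≫ d = act₁ a ∧ d ≫ c = act₁' a) ∧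
        (∀ b, 𝔟 b → ∃ f : A₁.X ⟶ A₁'.X, c ≫ act₁' b = f ≫ act₁' ν) ∧
        c ≫ lam₁' ≫ DualPair.dualIsogenyOver c D₁ D₁' = lam₁ ≫ D₁.hat.mulN n ∧
        (∀ a, act₁ a ≫ c = c ≫ act₁' a) ∧
        (∀ i : J, (AlgPoints.map c (pt₁ i) : A₁'.toAffine.toAbelianVariety.Points Ω) = pt₁' i)) :
    ∃ (c : (A₁.baseChange e).X ⟶ (A₁'.baseChange e).X) (_ : IsMonHom c),
        (∀ a, 𝔞 a → ∃ d : (A₁'.baseChange e).X ⟶ (A₁.baseChange e).X,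
          c ≫ d = baseChangeHom (act₁ a) e ∧ d ≫ c = baseChangeHom (act₁' a) e) ∧
        (∀ b, 𝔟 b → ∃ f : (A₁.baseChange e).X ⟶ (A₁'.baseChange e).X,
          c ≫ baseChangeHom (act₁' b) e = f ≫ baseChangeHom (act₁' ν) e) ∧
        c ≫ baseChangeHom lam₁' e ≫ DualPair.dualIsogenyOver c (D₁.baseChange e) (D₁'.baseChange e) =
          baseChangeHom lam₁ e ≫ (D₁.baseChange e).hat.mulN n ∧
        (∀ a, baseChangeHom (act₁ a) e ≫ c = c ≫ baseChangeHom (act₁' a) e) ∧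
        (∀ i : J, (AlgPoints.map c (pt₂ i) : (A₁'.baseChange e).toAffine.toAbelianVariety.Points Ω') = pt₂' i) := by
  obtain ⟨c, hc, t1, t2, t3, t4, t5⟩ := hcover
  haveI := hc
  refine ⟨baseChangeHom c e, isMonHom_baseChangeHom c e, fun a ha => ?_, fun b hb => ?_,
    DualPair.baseChangeHom_similitude_base e c D₁ D₁' lam₁ lam₁' n t3, fun a => ?_, fun i => ?_⟩
  · obtain ⟨d, hcd, hdc⟩ := t1 a ha
    refine ⟨baseChangeHom d e, ?_, ?_⟩
    · change (Over.pullback e).map c ≫ (Over.pullback e).map d = (Over.pullback e).map (act₁ a)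
      rw [← Functor.map_comp, hcd]
    · change (Over.pullback e).map d ≫ (Over.pullback e).map c = (Over.pullback e).map (act₁' a)
      rw [← Functor.map_comp, hdc]
  · obtain ⟨f, hf⟩ := t2 b hb
    refine ⟨baseChangeHom f e, ?_⟩
    change (Over.pullback e).map c ≫ (Over.pullback e).map (act₁' b) = (Over.pullback e).map f ≫ (Over.pullback e).map (act₁' ν)
    rw [← Functor.map_comp, ← Functor.map_comp, hf]
  · change (Over.pullback e).map (act₁ a) ≫ (Over.pullback e).map c = (Over.pullback e).map c ≫ (Over.pullback e).map (act₁' a)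
    rw [← Functor.map_comp, ← Functor.map_comp, t4 a]
  · rw [hpt, hpt', ← pointsTransfer_map hε₁ hε₁' c, t5 i]

end Cover

end AbelianSchemeOver

end Literature.AlgebraicGeometry.AbelianSchemes

end
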